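import Mathlib

/-!
# `SnSubsetDichotomy.NoThresholdSubsetTriple`, line `klr-graded-polynomial-method`:
# the sub-goal `box_of_rowLen_colLen`

Infrastructure for the open stub `stub_freedmanSplit` of crux `stmt-MatrixMultiplication-8302`:
the bridge between the two forms of the "shape fits in a box" condition.  If the first row and
the first column of a Young diagram `Y` are both shorter than a real bound `B`
(`Y.rowLen 0 < B`, `Y.colLen 0 < B`), then every cell `(i, j)` of `Y` satisfies `i < B` and
`j < B`.

Proof.  For `(i, j) ∈ Y` we have `j < Y.rowLen i ≤ Y.rowLen 0` (`YoungDiagram.mem_iff_lt_rowLen`,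
`YoungDiagram.rowLen_anti`) and `i < Y.colLen j ≤ Y.colLen 0` (`YoungDiagram.mem_iff_lt_colLen`,
`YoungDiagram.colLen_anti`); cast to `ℝ` and chain with the hypotheses.
-/

namespace Summit.MatrixMultiplication.MatrixMultiplication.Theorems

set_option linter.dupNamespace false in -- deliberate Summit.<S>.<P> duplicate
/-- If the first row and the first column of a Young diagram `Y` are both shorter than `B`, then
every cell of `Y` lies in the box `[0, B) × [0, B)`: its row index and its column index are both
`< B`. [folklore] -/
theorem box_of_rowLen_colLen : ∀ (Y : YoungDiagram) (B : ℝ), (Y.rowLen 0 : ℝ) < B →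
    (Y.colLen 0 : ℝ) < B → ∀ x ∈ Y.cells, (x.1 : ℝ) < B ∧ (x.2 : ℝ) < B := by
  intro Y B hrow hcol x hx
  obtain ⟨i, j⟩ := x
  rw [YoungDiagram.mem_cells] at hx
  have hj : j < Y.rowLen 0 :=
    (YoungDiagram.mem_iff_lt_rowLen.mp hx).trans_le (Y.rowLen_anti 0 i (Nat.zero_le i))
  have hi : i < Y.colLen 0 :=
    (YoungDiagram.mem_iff_lt_colLen.mp hx).trans_le (Y.colLen_anti 0 j (Nat.zero_le j))
  refine ⟨lt_trans ?_ hcol, lt_trans ?_ hrow⟩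
  · exact_mod_cast hi
  · exact_mod_cast hj

end Summit.MatrixMultiplication.MatrixMultiplication.Theorems
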